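import Summits.CriticalPhenomena.PercolationContinuityZ3.Theorems.PercNearOneGluingNoHeavyLowerTailSahiThreeCopyNested

/-!
# `NoHeavyLowerTail` (crux stmt-CriticalPhenomena-4575), Sahi programme: **THE ONE-SLOT KERNEL OF THE THREE-COPY SAHI
# COEFFICIENT, ITS SIGN LAW, AND THE HALL (UPWARD-TRANSPORT) FORM OF 3C-SAHI** — `c_b(f,g,h) = Σ_z h(z)·K_b^{f,g}(z)` with
# `K ≥ 0` exactly on `{f = g = 1}` and `K ≤ 0` on `{f = 0} ∪ {g = 0}`; hence 3C-SAHI ⟺ a Hall condition on up-set thirds,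
# and the REDUCTION of 3C-SAHI to triples whose third event is generated outside the intersection of the other two

Support file (Sahi cell, seat `prim-sahi-p1`, generation 55; `--supports stmt-CriticalPhenomena-4575`); companion of
`…SahiThreeCopy` / `…SahiThreeCopyNested` (generation 53).  Typed on the census's reformulation CENSUS §190 (W211,
prim-sahi-census gen 57): "tc is linear in h, `tc_b(f,g,h) = Σ_{z∈h} K_{f,g}(b,z)` … KERNEL SIGN STRUCTURE … `K ≥ 0` exactly on
`f∩g`, `≤ 0` off it ⇒ 3C-SAHI ⟺ UPWARD HALL CONDITION `Σ_{z∈h∩f∩g} K⁺ ≥ Σ_{z∈h∖(f∩g)} K⁻`", verified there on every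
coefficient for `d ≤ 5`; here it is a theorem for every `d`, with the elementary identities behind it.

WHAT IS PROVED (all `d`, all profiles `b`; `δ_z` = `ptInd z` the indicator of the point `z`):
* `tc_add_right`, `tc_smul_right`, `tc_sum_smul_right`, `tc_eq_sum_kernel` — `c_b` is linear in its third slot and
  `c_b(f,g,h) = Σ_z h(z)·K_b(f,g;z)` with the ONE-SLOT KERNEL `K_b(f,g;z) := c_b(f,g,δ_z)` (`kerK`).
* `kerK_eq` — the explicit form `K_b(f,g;z) = 2f(z)g(z)·N_b(1;1;δ_z) − g(z)·N_b(f;1;δ_z) − f(z)·N_b(1;g;δ_z) − N_b(fg;1;δ_z)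
  + N_b(f;g;δ_z)` (the census's `Q^{(α,β)} = ONE(2αβ·ONE − βP_f − αP_g − P_{fg}) + P_f P_g` read coefficientwise).
* THE SIGN LAW for `[0,1]`-valued monotone `f, g`:
  `kerK_of_one_one` / `kerK_nonneg` — if `f(z) = g(z) = 1` then `K = N_b(1−f;1−g;δ_z) + N_b(1;1−fg;δ_z) ≥ 0`;
  `kerK_of_left_zero` / `kerK_nonpos_of_left_zero` — if `f(z) = 0` then `K = −g(z)N_b(f;1;δ_z) − [N_b(fg;1;δ_z) − N_b(f;g;δ_z)] ≤ 0`
  (three-copy Harris with the spectator `δ_z`); `kerK_nonpos_of_right_zero` (symmetric); for indicators of up-sets `A, B`: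
  `K ≥ 0` at `z ∈ A ∩ B` and `K ≤ 0` at `z ∉ A ∩ B` (`kerK_setInd_nonneg`, `kerK_setInd_nonpos`).
* THE HALL FORM: `tc_setInd_eq_sum_kerK` (`c_b(1_A,1_B,1_C) = Σ_{z∈C} K`), the split into the positive part over `C ∩ A ∩ B`
  and the negative part over `C ∖ (A ∩ B)` (`tc_setInd_eq_pos_add_neg`), and **`threeCopySahiSets_iff_hall`**: 3C-SAHI ⟺ for
  all up-sets `A, B, C` and profiles `b`, `Σ_{z ∈ C∖(A∩B)} (−K_b(1_A,1_B;z)) ≤ Σ_{z ∈ C∩A∩B} K_b(1_A,1_B;z)` — by max-flow/min-cut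
  on the cube poset this is the existence, for every `(A, B, b)`, of an UPWARD TRANSPORT of the defect `K⁻` (off `A∩B`) into the
  surplus `K⁺` (on the up-set `A∩B`) along the order (CENSUS §190–§191; the transport itself is not formalised here).
* MONOTONICITY IN THE THIRD EVENT and the REDUCTION: enlarging `C` inside `A ∩ B` increases `c_b`, enlarging it outside `A ∩ B`
  decreases `c_b` (`tc_setInd_mono_of_sdiff_subset`, `tc_setInd_anti_of_sdiff_disjoint`); hence for an up-set `C` the up-set
  `C' = ↑(C ∖ (A∩B)) ⊆ C` generated by the points of `C` outside `A ∩ B` has `c_b(1_A,1_B,1_{C'}) ≤ c_b(1_A,1_B,1_C)`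
  (`tc_setInd_upCl_sdiff_le`), and **`threeCopySahiSets_iff_reduced`**: 3C-SAHI holds iff it holds for the triples whose third
  event is GENERATED OUTSIDE the intersection of the other two (`C = ↑(C ∖ (A∩B))`, i.e. no minimal element of `C` lies in
  `A ∩ B`).  [The same reduction applies to each slot by symmetry; the law-level shadow is the identical statement for Kahn's
  Conjecture 5, since `E₃(1_A,1_B,h) = E[h·w]` with `w = 2·1_{A∩B} − μ(B)1_A − μ(A)1_B − Cov(1_A,1_B)` of the same sign pattern.]
Nothing conjectural is used; `ThreeCopySahiSets` appears only inside `↔` statements.  [this work; reformulation: CENSUS §190 W211]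
-/

namespace Summit.CriticalPhenomena.PercolationContinuityZ3.Theorems.SahiThreeCopy

open Finset Function Literature.Combinatorics.Sahi2008
open scoped BigOperators

noncomputable section

variable {d : ℕ}

/-! ### §1 Linearity of `c_b` in the third slot; the one-slot kernel -/

/-- The indicator of the single point `z`. [this work] -/
def ptInd (z : Pt d) : Pt d → ℝ := fun x => if x = z then 1 else 0

/-- `δ_z ≥ 0`. [this work] -/
theorem ptInd_nonneg (z x : Pt d) : 0 ≤ ptInd z x := by
  unfold ptInd; split_ifs <;> norm_num

/-- `u · δ_z = u(z) · δ_z`. [this work] -/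
theorem mul_ptInd (u : Pt d → ℝ) (z : Pt d) : u * ptInd z = u z • ptInd z := by
  funext x
  simp only [Pi.mul_apply, Pi.smul_apply, smul_eq_mul, ptInd]
  split_ifs with h
  · subst h; ring
  · ring

/-- A function on the cube is the sum of its values times point indicators. [this work] -/
theorem eq_sum_smul_ptInd (h : Pt d → ℝ) : h = ∑ z : Pt d, h z • ptInd z := by
  funext x
  rw [Finset.sum_apply]
  simp only [Pi.smul_apply, smul_eq_mul, ptInd, mul_ite, mul_one, mul_zero]
  rw [Finset.sum_ite_eq Finset.univ x]
  simp

/-- `c_b` is symmetric in its first and third arguments. [this work] -/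
theorem tc_comm13 (b : Fin d → ℕ) (f g h : Pt d → ℝ) : tc b f g h = tc b h g f := by
  rw [tc_comm23, tc_comm12, tc_comm23]

/-- `c_b` is additive in its third slot. [this work] -/
theorem tc_add_right (b : Fin d → ℕ) (f g h h' : Pt d → ℝ) : tc b f g (h + h') = tc b f g h + tc b f g h' := by
  rw [tc_comm13, tc_add_left, tc_comm13 b h g f, tc_comm13 b h' g f]

/-- `c_b` is homogeneous in its third slot. [this work] -/
theorem tc_smul_right (b : Fin d → ℕ) (c : ℝ) (f g h : Pt d → ℝ) : tc b f g (c • h) = c * tc b f g h := by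
  rw [tc_comm13, tc_smul_left, tc_comm13 b h g f]

/-- `c_b` of a finite weighted sum in the third slot. [this work] -/
theorem tc_sum_smul_right (b : Fin d → ℕ) (f g : Pt d → ℝ) {ι : Type*} (s : Finset ι) (c : ι → ℝ) (H : ι → Pt d → ℝ) :
    tc b f g (∑ i ∈ s, c i • H i) = ∑ i ∈ s, c i * tc b f g (H i) := by
  classical
  induction s using Finset.induction_on with
  | empty =>
    rw [Finset.sum_empty, Finset.sum_empty]
    have : (0 : Pt d → ℝ) = (0 : ℝ) • (0 : Pt d → ℝ) := by simp
    rw [this, tc_smul_right, zero_mul]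
  | insert i s hi ih =>
    rw [Finset.sum_insert hi, Finset.sum_insert hi, tc_add_right, tc_smul_right, ih]

/-- The ONE-SLOT KERNEL of the three-copy Sahi coefficient: `K_b(f,g;z) := c_b(f,g,δ_z)`. [this work; CENSUS §190 W211] -/
def kerK (b : Fin d → ℕ) (f g : Pt d → ℝ) (z : Pt d) : ℝ := tc b f g (ptInd z)

/-- **`c_b(f,g,h) = Σ_z h(z) · K_b(f,g;z)`** (linearity of `c_b` in the third slot). [this work; CENSUS §190 W211] -/
theorem tc_eq_sum_kernel (b : Fin d → ℕ) (f g h : Pt d → ℝ) : tc b f g h = ∑ z : Pt d, h z * kerK b f g z := by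
  conv_lhs => rw [eq_sum_smul_ptInd h]
  rw [tc_sum_smul_right]
  rfl

/-- The kernel is symmetric in `f, g`. [this work] -/
theorem kerK_comm (b : Fin d → ℕ) (f g : Pt d → ℝ) (z : Pt d) : kerK b f g z = kerK b g f z := by
  unfold kerK; rw [tc_comm12]

/-- **Explicit form of the kernel**:
`K_b(f,g;z) = 2f(z)g(z)·N_b(1;1;δ_z) − g(z)·N_b(f;1;δ_z) − f(z)·N_b(1;g;δ_z) − N_b(fg;1;δ_z) + N_b(f;g;δ_z)`. [this work; CENSUS §190 W211] -/
theorem kerK_eq (b : Fin d → ℕ) (f g : Pt d → ℝ) (z : Pt d) :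
    kerK b f g z = 2 * (f z * g z) * N3 b 1 1 (ptInd z) - g z * N3 b f 1 (ptInd z) - f z * N3 b 1 g (ptInd z) -
      N3 b (f * g) 1 (ptInd z) + N3 b f g (ptInd z) := by
  unfold kerK tc
  have e1 : f * g * ptInd z = (f z * g z) • ptInd z := by rw [mul_ptInd]; rfl
  have e2 : g * ptInd z = g z • ptInd z := mul_ptInd g z
  have e3 : f * ptInd z = f z • ptInd z := mul_ptInd f z
  rw [e1, e2, e3, N3_smul_left, N3_smul_mid, N3_smul_mid, N3_comm13 b (ptInd z) 1 1, N3_comm23 b f (ptInd z) 1,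
    N3_comm23 b g (ptInd z) 1, N3_comm12 b g 1 (ptInd z), N3_comm12 b (ptInd z) (f * g) 1, N3_comm23 b (f * g) (ptInd z) 1]
  ring

/-! ### §2 The sign law -/

/-- At a point where `f(z) = g(z) = 1`: `K_b(f,g;z) = N_b(1−f;1−g;δ_z) + N_b(1;1−fg;δ_z)`. [this work; CENSUS §190 W211 (`Q^{(1,1)}`)] -/
theorem kerK_of_one_one (b : Fin d → ℕ) (f g : Pt d → ℝ) {z : Pt d} (hf : f z = 1) (hg : g z = 1) :
    kerK b f g z = N3 b (1 - f) (1 - g) (ptInd z) + N3 b 1 (1 - f * g) (ptInd z) := by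
  rw [kerK_eq, hf, hg, N3_sub_left, N3_sub_mid, N3_sub_mid, N3_sub_mid, N3_comm12 b 1 (f * g) (ptInd z)]
  ring

/-- At a point where `f(z) = 0`: `K_b(f,g;z) = −g(z)·N_b(f;1;δ_z) − [N_b(fg;1;δ_z) − N_b(f;g;δ_z)]`. [this work; CENSUS §190 W211 (`Q^{(0,β)}`)] -/
theorem kerK_of_left_zero (b : Fin d → ℕ) (f g : Pt d → ℝ) {z : Pt d} (hf : f z = 0) :
    kerK b f g z = -(g z * N3 b f 1 (ptInd z)) - (N3 b (f * g) 1 (ptInd z) - N3 b f g (ptInd z)) := by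
  rw [kerK_eq, hf]
  ring

/-- At a point where `f(z) = 1` and `g(z) = 0`: `K_b(f,g;z) = −N_b(1−f;g;δ_z) − N_b(fg;1;δ_z)`. [this work; CENSUS §190 W211 (`Q^{(1,0)}`)] -/
theorem kerK_of_one_zero (b : Fin d → ℕ) (f g : Pt d → ℝ) {z : Pt d} (hf : f z = 1) (hg : g z = 0) :
    kerK b f g z = -N3 b (1 - f) g (ptInd z) - N3 b (f * g) 1 (ptInd z) := by
  rw [kerK_eq, hf, hg, N3_sub_left]
  ring

/-- **Sign law, positive part**: for `f ≤ 1`, `0 ≤ g ≤ 1` and a point with `f(z) = g(z) = 1`, `0 ≤ K_b(f,g;z)`. [this work; CENSUS §190 W211] -/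
theorem kerK_nonneg (b : Fin d → ℕ) {f g : Pt d → ℝ} (hf1 : ∀ x, f x ≤ 1) (hg0 : ∀ x, 0 ≤ g x)
    (hg1 : ∀ x, g x ≤ 1) {z : Pt d} (hf : f z = 1) (hg : g z = 1) : 0 ≤ kerK b f g z := by
  rw [kerK_of_one_one b f g hf hg]
  refine add_nonneg (N3_nonneg b (fun x => sub_nonneg.2 (hf1 x)) (fun x => sub_nonneg.2 (hg1 x)) (ptInd_nonneg z))
    (N3_nonneg b (fun _ => zero_le_one) (fun x => ?_) (ptInd_nonneg z))
  simp only [Pi.sub_apply, Pi.one_apply, Pi.mul_apply, sub_nonneg]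
  calc f x * g x ≤ 1 * 1 := mul_le_mul (hf1 x) (hg1 x) (hg0 x) zero_le_one
    _ = 1 := one_mul 1

/-- **Sign law, negative part**: for nonnegative monotone `f, g` and a point with `f(z) = 0`, `K_b(f,g;z) ≤ 0`
(three-copy Harris with the spectator `δ_z`). [this work; CENSUS §190 W211] -/
theorem kerK_nonpos_of_left_zero (b : Fin d → ℕ) {f g : Pt d → ℝ} (hf0 : ∀ x, 0 ≤ f x) (hfm : Monotone f)
    (hg0 : ∀ x, 0 ≤ g x) (hgm : Monotone g) {z : Pt d} (hf : f z = 0) : kerK b f g z ≤ 0 := by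
  rw [kerK_of_left_zero b f g hf]
  have h1 : 0 ≤ g z * N3 b f 1 (ptInd z) := mul_nonneg (hg0 z) (N3_nonneg b hf0 (fun _ => zero_le_one) (ptInd_nonneg z))
  have h2 := harris3_nonneg b hf0 hfm hg0 hgm (ptInd_nonneg z)
  linarith

/-- Sign law, negative part, symmetric version: `g(z) = 0 ⇒ K_b(f,g;z) ≤ 0`. [this work] -/
theorem kerK_nonpos_of_right_zero (b : Fin d → ℕ) {f g : Pt d → ℝ} (hf0 : ∀ x, 0 ≤ f x) (hfm : Monotone f)
    (hg0 : ∀ x, 0 ≤ g x) (hgm : Monotone g) {z : Pt d} (hg : g z = 0) : kerK b f g z ≤ 0 := by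
  rw [kerK_comm]
  exact kerK_nonpos_of_left_zero b hg0 hgm hf0 hfm hg

/-- Events form, positive part: `z ∈ A ∩ B ⇒ 0 ≤ K_b(1_A,1_B;z)` (any finsets `A, B`). [this work] -/
theorem kerK_setInd_nonneg (b : Fin d → ℕ) (A B : Finset (Pt d)) {z : Pt d} (hz : z ∈ A ∩ B) :
    0 ≤ kerK b (setInd A) (setInd B) z := by
  rw [Finset.mem_inter] at hz
  refine kerK_nonneg b (fun x => ?_) (setInd_nonneg B) (fun x => ?_) ?_ ?_
  · unfold setInd; split_ifs <;> norm_num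
  · unfold setInd; split_ifs <;> norm_num
  · simp [setInd_apply, hz.1]
  · simp [setInd_apply, hz.2]

/-- Events form, negative part: for up-sets `A, B` and `z ∉ A ∩ B`, `K_b(1_A,1_B;z) ≤ 0`. [this work] -/
theorem kerK_setInd_nonpos (b : Fin d → ℕ) {A B : Finset (Pt d)} (hA : IsUpperSet (A : Set (Pt d)))
    (hB : IsUpperSet (B : Set (Pt d))) {z : Pt d} (hz : z ∉ A ∩ B) : kerK b (setInd A) (setInd B) z ≤ 0 := by
  rw [Finset.mem_inter, not_and_or] at hz
  rcases hz with hz | hz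
  · exact kerK_nonpos_of_left_zero b (setInd_nonneg A) (monotone_setInd hA) (setInd_nonneg B) (monotone_setInd hB)
      (by simp [setInd_apply, hz])
  · exact kerK_nonpos_of_right_zero b (setInd_nonneg A) (monotone_setInd hA) (setInd_nonneg B) (monotone_setInd hB)
      (by simp [setInd_apply, hz])

/-! ### §3 The Hall form of 3C-SAHI -/

/-- `c_b(1_A,1_B,1_C) = Σ_{z ∈ C} K_b(1_A,1_B;z)`. [this work; CENSUS §190 W211] -/
theorem tc_setInd_eq_sum_kerK (b : Fin d → ℕ) (A B C : Finset (Pt d)) :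
    tc b (setInd A) (setInd B) (setInd C) = ∑ z ∈ C, kerK b (setInd A) (setInd B) z := by
  rw [tc_eq_sum_kernel]
  simp only [setInd_apply, ite_mul, one_mul, zero_mul]
  rw [Finset.sum_ite_mem, Finset.univ_inter]

/-- The split of `c_b(1_A,1_B,1_C)` into its POSITIVE part (over `C ∩ (A ∩ B)`) and its NEGATIVE part (over `C ∖ (A ∩ B)`). [this work] -/
theorem tc_setInd_eq_pos_add_neg (b : Fin d → ℕ) (A B C : Finset (Pt d)) :
    tc b (setInd A) (setInd B) (setInd C) =
      ∑ z ∈ C ∩ (A ∩ B), kerK b (setInd A) (setInd B) z + ∑ z ∈ C \ (A ∩ B), kerK b (setInd A) (setInd B) z := by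
  rw [tc_setInd_eq_sum_kerK, ← Finset.sum_sdiff (Finset.inter_subset_left : C ∩ (A ∩ B) ⊆ C),
    Finset.sdiff_inter_self_left, add_comm]

/-- The positive part is nonnegative. [this work] -/
theorem sum_kerK_inter_nonneg (b : Fin d → ℕ) (A B C : Finset (Pt d)) :
    0 ≤ ∑ z ∈ C ∩ (A ∩ B), kerK b (setInd A) (setInd B) z :=
  Finset.sum_nonneg fun _ hz => kerK_setInd_nonneg b A B (Finset.mem_inter.1 hz).2

/-- The negative part is nonpositive (up-sets `A, B`). [this work] -/
theorem sum_kerK_sdiff_nonpos (b : Fin d → ℕ) {A B : Finset (Pt d)} (hA : IsUpperSet (A : Set (Pt d)))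
    (hB : IsUpperSet (B : Set (Pt d))) (C : Finset (Pt d)) :
    ∑ z ∈ C \ (A ∩ B), kerK b (setInd A) (setInd B) z ≤ 0 :=
  Finset.sum_nonpos fun _ hz => kerK_setInd_nonpos b hA hB (Finset.mem_sdiff.1 hz).2

/-- `c_b(1_A,1_B,1_C) ≥ 0` iff the HALL INEQUALITY `Σ_{C∖(A∩B)} (−K) ≤ Σ_{C∩A∩B} K` holds. [this work] -/
theorem tc_setInd_nonneg_iff_hall (b : Fin d → ℕ) (A B C : Finset (Pt d)) :
    0 ≤ tc b (setInd A) (setInd B) (setInd C) ↔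
      ∑ z ∈ C \ (A ∩ B), -kerK b (setInd A) (setInd B) z ≤ ∑ z ∈ C ∩ (A ∩ B), kerK b (setInd A) (setInd B) z := by
  rw [tc_setInd_eq_pos_add_neg, Finset.sum_neg_distrib]
  constructor <;> intro h <;> linarith

/-- **3C-SAHI ⟺ the upward Hall condition** (CENSUS §190): for all up-sets `A, B, C ⊆ {0,1}^d` and every profile `b`, the
defect of the kernel on `C ∖ (A∩B)` is at most its surplus on `C ∩ A ∩ B`:
`Σ_{z ∈ C∖(A∩B)} (−K_b(1_A,1_B;z)) ≤ Σ_{z ∈ C∩A∩B} K_b(1_A,1_B;z)` (both sides nonnegative by the sign law). [this work; CENSUS §190 W211] -/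
theorem threeCopySahiSets_iff_hall : ThreeCopySahiSets ↔
    ∀ (d : ℕ) (b : Fin d → ℕ) (A B C : Finset (Pt d)), IsUpperSet (A : Set (Pt d)) → IsUpperSet (B : Set (Pt d)) →
      IsUpperSet (C : Set (Pt d)) →
        ∑ z ∈ C \ (A ∩ B), -kerK b (setInd A) (setInd B) z ≤ ∑ z ∈ C ∩ (A ∩ B), kerK b (setInd A) (setInd B) z := by
  refine ⟨fun H d b A B C hA hB hC => (tc_setInd_nonneg_iff_hall b A B C).1 (H d b A B C hA hB hC),
    fun H d b A B C hA hB hC => (tc_setInd_nonneg_iff_hall b A B C).2 (H d b A B C hA hB hC)⟩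

/-! ### §4 Monotonicity in the third event and the reduction to generated-outside thirds -/

/-- Enlarging the third event INSIDE `A ∩ B` increases `c_b`: if `C ⊆ C'` and `C' ∖ C ⊆ A ∩ B` then
`c_b(1_A,1_B,1_C) ≤ c_b(1_A,1_B,1_{C'})`. [this work] -/
theorem tc_setInd_mono_of_sdiff_subset (b : Fin d → ℕ) (A B : Finset (Pt d)) {C C' : Finset (Pt d)} (hCC' : C ⊆ C')
    (hdiff : C' \ C ⊆ A ∩ B) : tc b (setInd A) (setInd B) (setInd C) ≤ tc b (setInd A) (setInd B) (setInd C') := by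
  rw [tc_setInd_eq_sum_kerK, tc_setInd_eq_sum_kerK, ← Finset.sum_sdiff hCC']
  have : 0 ≤ ∑ z ∈ C' \ C, kerK b (setInd A) (setInd B) z :=
    Finset.sum_nonneg fun z hz => kerK_setInd_nonneg b A B (hdiff hz)
  linarith

/-- Enlarging the third event OUTSIDE `A ∩ B` decreases `c_b` (up-sets `A, B`): if `C ⊆ C'` and `C' ∖ C` misses `A ∩ B`
then `c_b(1_A,1_B,1_{C'}) ≤ c_b(1_A,1_B,1_C)`. [this work] -/
theorem tc_setInd_anti_of_sdiff_disjoint (b : Fin d → ℕ) {A B : Finset (Pt d)} (hA : IsUpperSet (A : Set (Pt d)))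
    (hB : IsUpperSet (B : Set (Pt d))) {C C' : Finset (Pt d)} (hCC' : C ⊆ C') (hdiff : Disjoint (C' \ C) (A ∩ B)) :
    tc b (setInd A) (setInd B) (setInd C') ≤ tc b (setInd A) (setInd B) (setInd C) := by
  rw [tc_setInd_eq_sum_kerK, tc_setInd_eq_sum_kerK, ← Finset.sum_sdiff hCC']
  have : ∑ z ∈ C' \ C, kerK b (setInd A) (setInd B) z ≤ 0 :=
    Finset.sum_nonpos fun z hz => kerK_setInd_nonpos b hA hB (Finset.disjoint_left.1 hdiff hz)
  linarith

open Classical in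
/-- The up-set generated by a finset of points of the cube (upper closure, as a finset). [this work] -/
def upCl (S : Finset (Pt d)) : Finset (Pt d) := Finset.univ.filter fun x => ∃ s ∈ S, s ≤ x

/-- Membership in the generated up-set. [this work] -/
theorem mem_upCl {S : Finset (Pt d)} {x : Pt d} : x ∈ upCl S ↔ ∃ s ∈ S, s ≤ x := by
  classical
  unfold upCl
  simp only [Finset.mem_filter, Finset.mem_univ, true_and]

/-- `S ⊆ ↑S`. [this work] -/
theorem subset_upCl (S : Finset (Pt d)) : S ⊆ upCl S := fun x hx => mem_upCl.2 ⟨x, hx, le_rfl⟩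

/-- `↑S` is an up-set. [this work] -/
theorem isUpperSet_upCl (S : Finset (Pt d)) : IsUpperSet (upCl S : Set (Pt d)) := by
  intro x y hxy hx
  rw [Finset.mem_coe, mem_upCl] at hx ⊢
  obtain ⟨s, hs, hsx⟩ := hx
  exact ⟨s, hs, hsx.trans hxy⟩

/-- An up-set contains the up-set generated by any of its subsets. [this work] -/
theorem upCl_subset_of_isUpperSet {S C : Finset (Pt d)} (hC : IsUpperSet (C : Set (Pt d))) (hSC : S ⊆ C) : upCl S ⊆ C := by
  intro x hx
  obtain ⟨s, hs, hsx⟩ := mem_upCl.1 hx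
  exact hC hsx (hSC hs)

/-- **Reduction of the third event**: for up-sets `A, B, C`, the up-set `↑(C ∖ (A∩B))` generated by the points of `C` outside
`A ∩ B` satisfies `c_b(1_A,1_B,1_{↑(C∖(A∩B))}) ≤ c_b(1_A,1_B,1_C)` (it is contained in `C` and the difference lies in `A ∩ B`). [this work] -/
theorem tc_setInd_upCl_sdiff_le (b : Fin d → ℕ) (A B : Finset (Pt d)) {C : Finset (Pt d)} (hC : IsUpperSet (C : Set (Pt d))) :
    tc b (setInd A) (setInd B) (setInd (upCl (C \ (A ∩ B)))) ≤ tc b (setInd A) (setInd B) (setInd C) := by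
  refine tc_setInd_mono_of_sdiff_subset b A B (upCl_subset_of_isUpperSet hC Finset.sdiff_subset) ?_
  intro x hx
  rw [Finset.mem_sdiff] at hx
  by_contra hxAB
  exact hx.2 (subset_upCl _ (Finset.mem_sdiff.2 ⟨hx.1, hxAB⟩))

/-- The generated-outside third is itself generated outside: `↑(C' ∖ (A∩B)) = C'` for `C' = ↑(C ∖ (A∩B))`. [this work] -/
theorem upCl_sdiff_idem (A B C : Finset (Pt d)) :
    upCl (upCl (C \ (A ∩ B)) \ (A ∩ B)) = upCl (C \ (A ∩ B)) := by
  apply Finset.Subset.antisymm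
  · exact upCl_subset_of_isUpperSet (isUpperSet_upCl _) Finset.sdiff_subset
  · -- every generator of `↑(C∖AB)` is a point of `↑(C∖AB)` outside `A ∩ B`
    intro x hx
    obtain ⟨s, hs, hsx⟩ := mem_upCl.1 hx
    refine mem_upCl.2 ⟨s, Finset.mem_sdiff.2 ⟨subset_upCl _ hs, (Finset.mem_sdiff.1 hs).2⟩, hsx⟩

/-- **3C-SAHI reduces to REDUCED thirds**: 3C-SAHI holds iff `c_b(1_A,1_B,1_C) ≥ 0` for all up-sets `A, B` and all up-sets
`C` GENERATED OUTSIDE `A ∩ B` (`C = ↑(C ∖ (A∩B))`, i.e. no minimal element of `C` lies in `A ∩ B`). [this work] -/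
theorem threeCopySahiSets_iff_reduced : ThreeCopySahiSets ↔
    ∀ (d : ℕ) (b : Fin d → ℕ) (A B C : Finset (Pt d)), IsUpperSet (A : Set (Pt d)) → IsUpperSet (B : Set (Pt d)) →
      IsUpperSet (C : Set (Pt d)) → upCl (C \ (A ∩ B)) = C → 0 ≤ tc b (setInd A) (setInd B) (setInd C) := by
  refine ⟨fun H d b A B C hA hB hC _ => H d b A B C hA hB hC, fun H d b A B C hA hB hC => ?_⟩
  exact (H d b A B (upCl (C \ (A ∩ B))) hA hB (isUpperSet_upCl _) (upCl_sdiff_idem A B C)).trans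
    (tc_setInd_upCl_sdiff_le b A B hC)

/-- The extreme third: over all up-sets `C`, `c_b(1_A,1_B,1_C)` is maximal at `C = A ∩ B`... more precisely, for every finset
`C`, `c_b(1_A,1_B,1_C) ≤ c_b(1_A,1_B,1_{A∩B})` when `A, B` are up-sets (all the surplus, none of the defect). [this work] -/
theorem tc_setInd_le_inter (b : Fin d → ℕ) {A B : Finset (Pt d)} (hA : IsUpperSet (A : Set (Pt d)))
    (hB : IsUpperSet (B : Set (Pt d))) (C : Finset (Pt d)) :
    tc b (setInd A) (setInd B) (setInd C) ≤ tc b (setInd A) (setInd B) (setInd (A ∩ B)) := by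
  rw [tc_setInd_eq_pos_add_neg b A B C, tc_setInd_eq_sum_kerK]
  have h1 := sum_kerK_sdiff_nonpos b hA hB C
  have h2 : ∑ z ∈ C ∩ (A ∩ B), kerK b (setInd A) (setInd B) z ≤ ∑ z ∈ A ∩ B, kerK b (setInd A) (setInd B) z :=
    Finset.sum_le_sum_of_subset_of_nonneg Finset.inter_subset_right fun z hz _ => kerK_setInd_nonneg b A B hz
  linarith

/-- The total kernel mass is the Harris gap: `Σ_z K_b(f,g;z) = c_b(f,g,1) = N_b(fg;1;1) − N_b(f;g;1)` — so over ALL of the cube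
the surplus beats the defect (coefficientwise Harris); 3C-SAHI asks this of every up-set. [this work] -/
theorem sum_kerK_eq_harris (b : Fin d → ℕ) (f g : Pt d → ℝ) :
    ∑ z : Pt d, kerK b f g z = N3 b (f * g) 1 1 - N3 b f g 1 := by
  rw [← tc_one_right, tc_eq_sum_kernel]
  simp


/-! ### §5 The class `A ∩ B ⊆ C` (appended, p1 gen55): one intersection inside the third event -/

/-- The indicator of the whole cube is the constant `1`. [this work] -/
theorem setInd_univ : setInd (Finset.univ : Finset (Pt d)) = (1 : Pt d → ℝ) := by
  funext x; simp [setInd_apply]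

/-- If `A ∩ B ⊆ C` (up-sets `A, B`; ANY finset `C`) then `c_b(1_A,1_B,1) ≤ c_b(1_A,1_B,1_C)`: outside `C` the kernel is
nonpositive, so dropping those points from the full cube only increases `c_b`. [this work] -/
theorem tc_setInd_one_le_of_inter_subset (b : Fin d → ℕ) {A B C : Finset (Pt d)} (hA : IsUpperSet (A : Set (Pt d)))
    (hB : IsUpperSet (B : Set (Pt d))) (hABC : A ∩ B ⊆ C) :
    tc b (setInd A) (setInd B) 1 ≤ tc b (setInd A) (setInd B) (setInd C) := by
  rw [← setInd_univ]
  refine tc_setInd_anti_of_sdiff_disjoint b hA hB (Finset.subset_univ C) ?_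
  rw [Finset.disjoint_left]
  intro z hz hzAB
  exact (Finset.mem_sdiff.1 hz).2 (hABC hzAB)

/-- **3C-SAHI when one pairwise intersection lies inside the third event**: for up-sets `A, B` and ANY `C ⊇ A ∩ B`,
`0 ≤ N_b(1_A 1_B;1;1) − N_b(1_A;1_B;1) = c_b(1_A,1_B,1) ≤ c_b(1_A,1_B,1_C)` at every profile `b` — the total kernel mass is the
coefficientwise Harris gap, and `C ⊇ A ∩ B` keeps all of the surplus.  (Contains the nested classes `A ⊆ C`, `B ⊆ C`; e.g. the
tight triple `(x₁, x₂, x₁ ∨ x₂)`.  Law level: `…SahiAbsorbed.sahiE_three_setInd_nonneg_of_inter_subset`.) [this work] -/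
theorem tc_setInd_nonneg_of_inter_subset (b : Fin d → ℕ) {A B C : Finset (Pt d)} (hA : IsUpperSet (A : Set (Pt d)))
    (hB : IsUpperSet (B : Set (Pt d))) (hABC : A ∩ B ⊆ C) : 0 ≤ tc b (setInd A) (setInd B) (setInd C) :=
  (tc_one_right_nonneg b (setInd_nonneg A) (monotone_setInd hA) (setInd_nonneg B) (monotone_setInd hB)).trans
    (tc_setInd_one_le_of_inter_subset b hA hB hABC)

/-- Slot permutation: `A ∩ C ⊆ B` (up-sets `A, C`). [this work] -/
theorem tc_setInd_nonneg_of_inter_subset₁₃ (b : Fin d → ℕ) {A B C : Finset (Pt d)} (hA : IsUpperSet (A : Set (Pt d)))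
    (hC : IsUpperSet (C : Set (Pt d))) (hACB : A ∩ C ⊆ B) : 0 ≤ tc b (setInd A) (setInd B) (setInd C) := by
  rw [tc_comm23]
  exact tc_setInd_nonneg_of_inter_subset b hA hC hACB

/-- Slot permutation: `B ∩ C ⊆ A` (up-sets `B, C`). [this work] -/
theorem tc_setInd_nonneg_of_inter_subset₂₃ (b : Fin d → ℕ) {A B C : Finset (Pt d)} (hB : IsUpperSet (B : Set (Pt d)))
    (hC : IsUpperSet (C : Set (Pt d))) (hBCA : B ∩ C ⊆ A) : 0 ≤ tc b (setInd A) (setInd B) (setInd C) := by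
  rw [tc_comm13]
  exact tc_setInd_nonneg_of_inter_subset b hC hB (by rwa [Finset.inter_comm])

/-- Quantitative form: for up-sets `A, B` and any `C`, `c_b(1_A,1_B,1_C) ≥ H_b(1_A,1_B) − Σ_{z ∈ (A∩B)∖C} K_b(1_A,1_B;z)` —
`c_b` falls short of the Harris gap by at most the surplus that `C` misses. [this work] -/
theorem tc_setInd_ge_harris_sub (b : Fin d → ℕ) {A B : Finset (Pt d)} (hA : IsUpperSet (A : Set (Pt d)))
    (hB : IsUpperSet (B : Set (Pt d))) (C : Finset (Pt d)) :
    (N3 b (setInd A * setInd B) 1 1 - N3 b (setInd A) (setInd B) 1) - ∑ z ∈ (A ∩ B) \ C, kerK b (setInd A) (setInd B) z ≤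
      tc b (setInd A) (setInd B) (setInd C) := by
  classical
  rw [← sum_kerK_eq_harris, tc_setInd_eq_sum_kerK, ← Finset.sum_sdiff (Finset.subset_univ C)]
  -- the points outside `C`: those in `A ∩ B` are subtracted exactly, the others contribute `≤ 0`
  have split : ∑ z ∈ Finset.univ \ C, kerK b (setInd A) (setInd B) z =
      ∑ z ∈ (Finset.univ \ C) ∩ (A ∩ B), kerK b (setInd A) (setInd B) z +
        ∑ z ∈ (Finset.univ \ C) \ (A ∩ B), kerK b (setInd A) (setInd B) z := by
    rw [← Finset.sum_sdiff (Finset.inter_subset_left : (Finset.univ \ C) ∩ (A ∩ B) ⊆ Finset.univ \ C),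
      Finset.sdiff_inter_self_left, add_comm]
  have e : (Finset.univ \ C) ∩ (A ∩ B) = (A ∩ B) \ C := by
    ext z; simp only [Finset.mem_inter, Finset.mem_sdiff, Finset.mem_univ, true_and]; tauto
  have neg : ∑ z ∈ (Finset.univ \ C) \ (A ∩ B), kerK b (setInd A) (setInd B) z ≤ 0 :=
    Finset.sum_nonpos fun z hz => kerK_setInd_nonpos b hA hB (Finset.mem_sdiff.1 hz).2
  rw [split, e]
  linarith

end

end Summit.CriticalPhenomena.PercolationContinuityZ3.Theorems.SahiThreeCopy
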